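import Literature.Geometry.Kaehler.HodgeStarContractWedgeOneProofs
import Literature.LinearAlgebra.Alternating.WedgeOneCommutatorProofs
import Mathlib.Analysis.Complex.Basic
import Mathlib.Analysis.Normed.Operator.Bilinear

/-!
# The symbol of `[∂̄*, L] - i∂` vanishes (Voisin, Lemma 6.6): pointwise linear algebra

Pointwise (linear-algebra) layer of the Kähler identity `[∂̄*, L] = i∂` on complex-valued
alternating forms `η : V [⋀^Fin k]→L[ℝ] ℂ` over an oriented even-dimensional real inner product
space `V` (a tangent space of a Hermitian manifold), in the CAR calculus of
`Literature/LinearAlgebra/Alternating/WedgeOne.lean` (`ξ ∧ η = wedgeOne ξ η`, `w ⌟ η = η.curryLeft w`):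

* the **complexified Hodge star** `⋆_ℂ η = ⋆(Re η) + i ⋆(Im η)` (the pointwise value of the tree's
  `MForm.cHodgeStar`), its `ℂ`-linearity and `⋆_ℂ (β ⊗ 1) = (⋆β) ⊗ 1`;
* `cHodgeStar_wedgeOne_cHodgeStar`: the complexification of `⋆(ξ ∧ ⋆γ) = ± ι_{ξ♯} γ`
  (`hodgeStar_wedgeOne_hodgeStar`): for a complex covector `ξ = ξ₁ + iξ₂`,
  `⋆_ℂ (ξ ∧ ⋆_ℂ γ) = (-1)^{km} (ι_{ξ₁♯} + i ι_{ξ₂♯}) γ`;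
* `curryLeftC_lefschetz_eq`: the complexified commutator `[ι_ξ, L_θ] η = (ι_ξ ω_θ) ∧ η`
  for the Lefschetz-type operator `L_θ η = alternatizeUncurryFin (v ↦ θ v ∧ η)` of a real
  covector family `θ` — a direct instance of `curryLeft_lefschetz_eq` /
  `curryLeft_lefschetz_zero` (`Literature/LinearAlgebra/Alternating/WedgeOneCommutatorProofs.lean`)
  at the canonical family `v ↦ θ v ∧ η` (`lefFam_apply`); no separate real-form restatement is kept
  here;
* `inner_J_contract_eq` : for `θ v = ½⟪Jv, ·⟫` with `J` skew (`⟪Ju, v⟫ = -⟪u, Jv⟫`) and `ξ` of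
  type `(1,0)` (`ξ ∘ J = iξ`), `ι_ξ ω_θ = -iξ`;
* `symbol_dolbeaultBarAdjoint_lefschetz_sub` (**Lemma 6.6, symbol form**): for even `n`,
  `-⋆_ℂ(ξ ∧ ⋆_ℂ(L_θ β)) + L_θ(⋆_ℂ(ξ ∧ ⋆_ℂ β)) - i (ξ ∧ β) = 0` for every `(1,0)`-covector `ξ`
  and every complex form `β` of positive degree, and the degree-`0` companion
  `symbol_dolbeaultBarAdjoint_lefschetz_zero`. Since `∂̄*(fγ) - f∂̄*γ = -⋆_ℂ(∂f ∧ ⋆_ℂ γ)` and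
  `∂(fγ) - f∂γ = ∂f ∧ γ`, this says exactly that the first-order operator
  `P = [∂̄*, L] - i∂` commutes with multiplication by smooth functions, i.e. is of order `0`
  (Voisin (2002), §6.1.1: proof of Lemma 6.6 computes `[∂̄*, L]` on `ℂⁿ` with
  `∂̄* = -∑ 2 ∂_i ∘ int(∂/∂z̄_i)` and `[int(v), ω ∧] = (ι_v ω) ∧`; Huybrechts (2005), Prop. 1.2.26
  and proof of Prop. 3.1.12).

All operators are written out (local notations only, no new definitions).

## References

* C. Voisin, *Hodge Theory and Complex Algebraic Geometry I* (2002), §6.1.1, Prop. 6.5,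
  Lemma 6.6, pp. 139–140. [Voisin2002]
* D. Huybrechts, *Complex Geometry* (2005), Lemma 1.2.24, Prop. 1.2.26, Prop. 3.1.12.
  [Huybrechts2005]
-/

noncomputable section

open Module ContinuousAlternatingMap Function Complex
open Literature.LinearAlgebra.Alternating

namespace Literature.Geometry.Kaehler

set_option quotPrecheck false

/-- Real part of a complex-valued alternating form. -/
local notation "𝔯" η:max => ContinuousLinearMap.compContinuousAlternatingMap Complex.reCLM η
/-- Imaginary part of a complex-valued alternating form. -/
local notation "𝔦" η:max => ContinuousLinearMap.compContinuousAlternatingMap Complex.imCLM η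
/-- Complexification of a real-valued alternating form. -/
local notation "𝔠" β:max => ContinuousLinearMap.compContinuousAlternatingMap Complex.ofRealCLM β
/-- Complexification of a real covector. -/
local notation "𝔠₁" ξ:max => ContinuousLinearMap.comp Complex.ofRealCLM ξ

section ComplexForms

variable {V : Type*} [NormedAddCommGroup V] [NormedSpace ℝ V] {k : ℕ}

/-- `Re (β ⊗ 1) = β`. [folklore] -/
@[simp] theorem re_ofRealForm (β : V [⋀^Fin k]→L[ℝ] ℝ) : 𝔯 (𝔠 β) = β := by
  ext v; simp

/-- `Im (β ⊗ 1) = 0`. [folklore] -/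
@[simp] theorem im_ofRealForm (β : V [⋀^Fin k]→L[ℝ] ℝ) : 𝔦 (𝔠 β) = 0 := by
  ext v; simp

/-- `Re (iη) = -Im η`. [folklore] -/
@[simp] theorem re_I_smul (η : V [⋀^Fin k]→L[ℝ] ℂ) : 𝔯 (I • η) = -𝔦 η := by
  ext v; simp

/-- `Im (iη) = Re η`. [folklore] -/
@[simp] theorem im_I_smul (η : V [⋀^Fin k]→L[ℝ] ℂ) : 𝔦 (I • η) = 𝔯 η := by
  ext v; simp

/-- `Re`, `Im` are additive. [folklore] -/
theorem re_add' (η η' : V [⋀^Fin k]→L[ℝ] ℂ) : 𝔯 (η + η') = 𝔯 η + 𝔯 η' := by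
  ext v; simp

/-- `Im` is additive. [folklore] -/
theorem im_add' (η η' : V [⋀^Fin k]→L[ℝ] ℂ) : 𝔦 (η + η') = 𝔦 η + 𝔦 η' := by
  ext v; simp

/-- Complexification is additive. [folklore] -/
theorem ofRealForm_add (β β' : V [⋀^Fin k]→L[ℝ] ℝ) : 𝔠 (β + β') = 𝔠 β + 𝔠 β' := by
  ext v; simp

/-- Complexification is `ℝ`-linear. [folklore] -/
theorem ofRealForm_smul (c : ℝ) (β : V [⋀^Fin k]→L[ℝ] ℝ) : 𝔠 (c • β) = (c : ℂ) • 𝔠 β := by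
  ext v; simp

/-- `𝔠 0 = 0`. [folklore] -/
@[simp] theorem ofRealForm_zero : 𝔠 (0 : V [⋀^Fin k]→L[ℝ] ℝ) = 0 := by
  ext v; simp

/-- `𝔠 (-β) = -𝔠 β`. [folklore] -/
theorem ofRealForm_neg (β : V [⋀^Fin k]→L[ℝ] ℝ) : 𝔠 (-β) = -𝔠 β := by
  ext v; simp

/-- **Decomposition** `η = Re η ⊗ 1 + i (Im η ⊗ 1)`. [folklore] -/
theorem ofRealForm_re_add_I_smul_ofRealForm_im (η : V [⋀^Fin k]→L[ℝ] ℂ) :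
    𝔠 (𝔯 η) + I • 𝔠 (𝔦 η) = η := by
  ext v; simp [mul_comm Complex.I, Complex.re_add_im]

/-- Decomposition of a complex covector `ξ = Re ξ ⊗ 1 + i (Im ξ ⊗ 1)`. [folklore] -/
theorem ofRealCLM_comp_re_add (ξ : V →L[ℝ] ℂ) :
    𝔠₁ (reCLM.comp ξ) + I • 𝔠₁ (imCLM.comp ξ) = ξ := by
  ext v; simp [mul_comm Complex.I, Complex.re_add_im]

/-- Interior product commutes with complexification. [folklore] -/
theorem curryLeft_ofRealForm (β : V [⋀^Fin (k + 1)]→L[ℝ] ℝ) (u : V) :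
    (𝔠 β).curryLeft u = 𝔠 (β.curryLeft u) := by
  ext v; simp

/-- Wedge with a complexified covector of a complexified form is the complexified real wedge.
[folklore] -/
theorem wedgeOne_ofReal_ofRealForm (ξ : V →L[ℝ] ℝ) (β : V [⋀^Fin k]→L[ℝ] ℝ) :
    wedgeOne (𝔠₁ ξ) (𝔠 β) = 𝔠 (wedgeOne ξ β) := by
  ext v; simp [wedgeOne_apply]

/-- A real covector acting on complex forms: through `ℝ`-scalars or through its complexification,
the wedge is the same. [folklore] -/
theorem wedgeOne_ofRealCLM_comp (ξ : V →L[ℝ] ℝ) (η : V [⋀^Fin k]→L[ℝ] ℂ) :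
    wedgeOne (𝔠₁ ξ) η = wedgeOne ξ η := by
  ext v; simp [wedgeOne_apply, Complex.real_smul]

/-- `Re ((-1)^n) = (-1)^n` in `ℂ`. [folklore] -/
theorem neg_one_pow_re (n : ℕ) : ((-1 : ℂ) ^ n).re = (-1) ^ n := by
  rw [show (-1 : ℂ) = ((-1 : ℝ) : ℂ) by norm_num, ← Complex.ofReal_pow, Complex.ofReal_re]

/-- `Im ((-1)^n) = 0` in `ℂ`. [folklore] -/
theorem neg_one_pow_im (n : ℕ) : ((-1 : ℂ) ^ n).im = 0 := by
  rw [show (-1 : ℂ) = ((-1 : ℝ) : ℂ) by norm_num, ← Complex.ofReal_pow, Complex.ofReal_im]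

/-- Wedge with a real covector commutes with taking real parts. [folklore] -/
theorem re_wedgeOne_real (ξ : V →L[ℝ] ℝ) (η : V [⋀^Fin k]→L[ℝ] ℂ) :
    𝔯 (wedgeOne ξ η) = wedgeOne ξ (𝔯 η) := by
  ext v; simp [wedgeOne_apply, neg_one_pow_re, neg_one_pow_im]

/-- Wedge with a real covector commutes with taking imaginary parts. [folklore] -/
theorem im_wedgeOne_real (ξ : V →L[ℝ] ℝ) (η : V [⋀^Fin k]→L[ℝ] ℂ) :
    𝔦 (wedgeOne ξ η) = wedgeOne ξ (𝔦 η) := by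
  ext v; simp [wedgeOne_apply, neg_one_pow_re, neg_one_pow_im]

/-- Wedge with a real covector of a complex form commutes with complex scalars. [folklore] -/
theorem wedgeOne_real_smul_complex (ξ : V →L[ℝ] ℝ) (c : ℂ) (η : V [⋀^Fin k]→L[ℝ] ℂ) :
    wedgeOne ξ (c • η) = c • wedgeOne ξ η := by
  ext v
  simp only [wedgeOne_apply, ContinuousAlternatingMap.smul_apply, smul_eq_mul, Finset.mul_sum,
    Complex.real_smul]
  refine Finset.sum_congr rfl fun i _ ↦ ?_
  ring

end ComplexForms

/-! ### The complexified Hodge star -/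

section CStar

/-- The complexified Hodge star `⋆_ℂ η = ⋆(Re η) ⊗ 1 + i (⋆(Im η) ⊗ 1)` of the orientation `o`
in degrees `h : k + m = n` (pointwise value of `MForm.cHodgeStar o h`). -/
local notation "⋆ℂ[" o ", " h "]" η:max =>
  ContinuousLinearMap.compContinuousAlternatingMap Complex.ofRealCLM
      (hodgeStar o h (ContinuousLinearMap.compContinuousAlternatingMap Complex.reCLM η)) +
    Complex.I • ContinuousLinearMap.compContinuousAlternatingMap Complex.ofRealCLM
      (hodgeStar o h (ContinuousLinearMap.compContinuousAlternatingMap Complex.imCLM η))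

variable {V : Type*} [NormedAddCommGroup V] [InnerProductSpace ℝ V] [FiniteDimensional ℝ V]
  {k m n : ℕ} [Fact (finrank ℝ V = n)] (o : Orientation ℝ V (Fin n))

/-- `⋆_ℂ (β ⊗ 1) = (⋆β) ⊗ 1`. [cite: Huybrechts2005, §1.2 p. 33] -/
theorem cHodgeStarPt_ofRealForm (h : k + m = n) (β : V [⋀^Fin k]→L[ℝ] ℝ) :
    ⋆ℂ[o, h] (𝔠 β) = 𝔠 (hodgeStar o h β) := by
  rw [re_ofRealForm, im_ofRealForm, LinearMap.map_zero, ofRealForm_zero]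
  ext v
  simp

/-- `⋆_ℂ` is additive. [folklore] -/
theorem cHodgeStarPt_add (h : k + m = n) (η η' : V [⋀^Fin k]→L[ℝ] ℂ) :
    ⋆ℂ[o, h] (η + η') = ⋆ℂ[o, h] η + ⋆ℂ[o, h] η' := by
  rw [re_add', im_add', map_add, map_add, ofRealForm_add, ofRealForm_add, smul_add]
  abel

/-- `⋆_ℂ (iη) = i ⋆_ℂ η`. [folklore] -/
theorem cHodgeStarPt_I_smul (h : k + m = n) (η : V [⋀^Fin k]→L[ℝ] ℂ) :
    ⋆ℂ[o, h] (I • η) = I • ⋆ℂ[o, h] η := by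
  rw [re_I_smul, im_I_smul, map_neg, ofRealForm_neg, smul_add, smul_smul, Complex.I_mul_I]
  ext v
  simp only [ContinuousAlternatingMap.add_apply, ContinuousAlternatingMap.neg_apply,
    ContinuousAlternatingMap.smul_apply, smul_eq_mul]
  ring

/-- Real part of `⋆_ℂ η` is `⋆ (Re η)`. [folklore] -/
@[simp] theorem re_cHodgeStarPt (h : k + m = n) (η : V [⋀^Fin k]→L[ℝ] ℂ) :
    𝔯 (⋆ℂ[o, h] η) = hodgeStar o h (𝔯 η) := by
  ext v; simp

/-- Imaginary part of `⋆_ℂ η` is `⋆ (Im η)`. [folklore] -/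
@[simp] theorem im_cHodgeStarPt (h : k + m = n) (η : V [⋀^Fin k]→L[ℝ] ℂ) :
    𝔦 (⋆ℂ[o, h] η) = hodgeStar o h (𝔦 η) := by
  ext v; simp

/-- **Complexified `⋆(ξ ∧ ⋆γ) = ±ι_{ξ♯} γ`.** For a complex covector `ξ` with real and imaginary
parts `ξ₁ = Re ∘ ξ`, `ξ₂ = Im ∘ ξ` and a complex `(k+1)`-form `γ`:
`⋆_ℂ (ξ ∧ ⋆_ℂ γ) = (-1)^{km} • (ι_{ξ₁♯} γ + i ι_{ξ₂♯} γ)` — the `ℂ`-bilinear extension of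
`hodgeStar_wedgeOne_hodgeStar`. [cite: Voisin2002, Lemma 6.6 (proof), p. 140] -/
theorem cHodgeStar_wedgeOne_cHodgeStar (h₁ : (k + 1) + m = n) (h₂ : (m + 1) + k = n)
    (ξ : V →L[ℝ] ℂ) (γ : V [⋀^Fin (k + 1)]→L[ℝ] ℂ) :
    ⋆ℂ[o, h₂] (wedgeOne ξ (⋆ℂ[o, h₁] γ)) =
      ((-1 : ℂ) ^ (k * m)) • (γ.curryLeft ((InnerProductSpace.toDual ℝ V).symm (reCLM.comp ξ)) +
        I • γ.curryLeft ((InnerProductSpace.toDual ℝ V).symm (imCLM.comp ξ))) := by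
  set ξ₁ : V →L[ℝ] ℝ := reCLM.comp ξ with hξ₁
  set ξ₂ : V →L[ℝ] ℝ := imCLM.comp ξ with hξ₂
  set u₁ : V := (InnerProductSpace.toDual ℝ V).symm ξ₁
  set u₂ : V := (InnerProductSpace.toDual ℝ V).symm ξ₂
  set γ₁ : V [⋀^Fin (k + 1)]→L[ℝ] ℝ := 𝔯 γ with hγ₁
  set γ₂ : V [⋀^Fin (k + 1)]→L[ℝ] ℝ := 𝔦 γ with hγ₂
  -- real identities
  have H := fun (a : V →L[ℝ] ℝ) (c : V [⋀^Fin (k + 1)]→L[ℝ] ℝ) ↦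
    hodgeStar_wedgeOne_hodgeStar o h₁ h₂ a c
  -- expand `ξ` and `⋆_ℂ γ`, push everything to complexified real forms
  have hξ : ξ = 𝔠₁ ξ₁ + I • 𝔠₁ ξ₂ := (ofRealCLM_comp_re_add ξ).symm
  have hγ : γ = 𝔠 γ₁ + I • 𝔠 γ₂ := (ofRealForm_re_add_I_smul_ofRealForm_im γ).symm
  -- the inner star
  have hin : ⋆ℂ[o, h₁] γ = 𝔠 (hodgeStar o h₁ γ₁) + I • 𝔠 (hodgeStar o h₁ γ₂) := rfl
  rw [hin, hξ]
  simp only [wedgeOne_add_left, wedgeOne_add, wedgeOne_smul_left, wedgeOne_smul,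
    wedgeOne_ofReal_ofRealForm, cHodgeStarPt_add, cHodgeStarPt_I_smul, cHodgeStarPt_ofRealForm, H,
    ofRealForm_smul]
  conv_rhs => rw [hγ]
  simp only [curryLeft_add, _root_.add_apply, curryLeft_smul', curryLeft_ofRealForm,
    smul_add, smul_smul]
  push_cast
  module

end CStar

/-! ### Lefschetz-type operators and complex contractions -/

section Lefschetz

variable {V : Type*} [NormedAddCommGroup V] [NormedSpace ℝ V] {j : ℕ}

/-- The complexified Hodge star (see above). -/
local notation "⋆ℂ[" o ", " h "]" η:max =>
  ContinuousLinearMap.compContinuousAlternatingMap Complex.ofRealCLM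
      (hodgeStar o h (ContinuousLinearMap.compContinuousAlternatingMap Complex.reCLM η)) +
    Complex.I • ContinuousLinearMap.compContinuousAlternatingMap Complex.ofRealCLM
      (hodgeStar o h (ContinuousLinearMap.compContinuousAlternatingMap Complex.imCLM η))

/-- The canonical continuous linear family `v ↦ θ v ∧ η` of a real covector family `θ`. -/
local notation "LefFam[" θ "]" η:max =>
  ContinuousLinearMap.comp (ContinuousAlternatingMap.alternatizeUncurryFinCLM ℝ V ℂ)
    (ContinuousLinearMap.comp (ContinuousLinearMap.flip
      (ContinuousLinearMap.smulRightL ℝ V (V [⋀^Fin _]→L[ℝ] ℂ)) η) θ)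

/-- The Lefschetz-type operator `L_θ η = alternatizeUncurryFin (v ↦ θ v ∧ η)`. -/
local notation "Lef[" θ "]" η:max => ContinuousAlternatingMap.alternatizeUncurryFin (LefFam[θ] η)

/-- The complex contraction `ι_{u₁ + i u₂} η = u₁ ⌟ η + i (u₂ ⌟ η)`. -/
local notation "ιℂ[" u₁ ", " u₂ "]" η:max =>
  ContinuousAlternatingMap.curryLeft η u₁ + Complex.I • ContinuousAlternatingMap.curryLeft η u₂

/-- The canonical family evaluates to `θ v ∧ η`. [folklore] -/
theorem lefFam_apply (θ : V →L[ℝ] V →L[ℝ] ℝ) (η : V [⋀^Fin j]→L[ℝ] ℂ) (v : V) :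
    (LefFam[θ] η) v = wedgeOne (θ v) η := by
  rw [ContinuousLinearMap.comp_apply, ContinuousLinearMap.comp_apply, ContinuousLinearMap.flip_apply,
    alternatizeUncurryFinCLM_apply, wedgeOne]
  rfl

/-- `L_θ` is additive. [folklore] -/
theorem lef_add (θ : V →L[ℝ] V →L[ℝ] ℝ) (η η' : V [⋀^Fin j]→L[ℝ] ℂ) :
    Lef[θ] (η + η') = Lef[θ] η + Lef[θ] η' := by
  rw [← alternatizeUncurryFin_add]
  congr 1
  ext v w
  rw [_root_.add_apply, lefFam_apply, lefFam_apply, lefFam_apply, wedgeOne_add]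

/-- `L_θ` commutes with complex scalars. [folklore] -/
theorem lef_smul (θ : V →L[ℝ] V →L[ℝ] ℝ) (c : ℂ) (η : V [⋀^Fin j]→L[ℝ] ℂ) :
    Lef[θ] (c • η) = c • Lef[θ] η := by
  rw [← alternatizeUncurryFin_smul]
  congr 1
  ext v w
  rw [_root_.smul_apply, lefFam_apply, lefFam_apply, wedgeOne_real_smul_complex]

/-- **`[ι_ξ, L_θ] = (ι_ξ ω_θ) ∧ ·`, complexified** (positive degree): for a real covector family
`θ`, vectors `u₁ u₂` (the duals of the real and imaginary parts of a complex covector) and a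
complex `(j+1)`-form `η`,
`ι (L_θ η) = L_θ (ι η) + ((θ u₁ - θᵗ u₁) ⊗ 1 + i (θ u₂ - θᵗ u₂) ⊗ 1) ∧ η` with
`ι = u₁ ⌟ + i u₂ ⌟`. The real identity `ι_w (L_θ η) = (θ w - θᵗ w) ∧ η + L_θ (ι_w η)` is
`curryLeft_lefschetz_eq` at the canonical family (`lefFam_apply`).
[cite: Voisin2002, Lemma 6.6 (proof)] -/
theorem curryLeftC_lefschetz_eq (θ : V →L[ℝ] V →L[ℝ] ℝ) (η : V [⋀^Fin (j + 1)]→L[ℝ] ℂ)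
    (u₁ u₂ : V) :
    ιℂ[u₁, u₂] (Lef[θ] η) = Lef[θ] (ιℂ[u₁, u₂] η) +
      wedgeOne (𝔠₁ (θ u₁ - θ.flip u₁) + I • 𝔠₁ (θ u₂ - θ.flip u₂)) η := by
  rw [curryLeft_lefschetz_eq θ η u₁ _ (lefFam_apply θ η) _ (lefFam_apply θ (η.curryLeft u₁)),
    curryLeft_lefschetz_eq θ η u₂ _ (lefFam_apply θ η) _ (lefFam_apply θ (η.curryLeft u₂)),
    lef_add θ (η.curryLeft u₁), lef_smul θ I (η.curryLeft u₂), wedgeOne_add_left,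
    wedgeOne_smul_left, wedgeOne_ofRealCLM_comp, wedgeOne_ofRealCLM_comp, smul_add]
  abel

/-- **`[ι_ξ, L_θ] = (ι_ξ ω_θ) ∧ ·`, complexified**, on `0`-forms (from `curryLeft_lefschetz_zero`
at the canonical family). [cite: Voisin2002, Lemma 6.6 (proof)] -/
theorem curryLeftC_lefschetz_zero (θ : V →L[ℝ] V →L[ℝ] ℝ) (η : V [⋀^Fin 0]→L[ℝ] ℂ) (u₁ u₂ : V) :
    ιℂ[u₁, u₂] (Lef[θ] η) =
      wedgeOne (𝔠₁ (θ u₁ - θ.flip u₁) + I • 𝔠₁ (θ u₂ - θ.flip u₂)) η := by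
  rw [curryLeft_lefschetz_zero θ η u₁ _ (lefFam_apply θ η),
    curryLeft_lefschetz_zero θ η u₂ _ (lefFam_apply θ η), wedgeOne_add_left, wedgeOne_smul_left,
    wedgeOne_ofRealCLM_comp, wedgeOne_ofRealCLM_comp]

end Lefschetz

/-! ### The contraction of the Kähler form with a `(1,0)`-covector -/

section Hermitian

open scoped RealInnerProductSpace

variable {V : Type*} [NormedAddCommGroup V] [InnerProductSpace ℝ V]

/-- For a skew operator `J` (`⟪Ju, v⟫ = -⟪u, Jv⟫`) and `θ v = ½⟪Jv, ·⟫`, the alternation of `θ`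
is the Kähler form: `θ u - θᵗ u = ⟪Ju, ·⟫ = ω(u, ·)`. [cite: Voisin2002, §3.1.1 Lemma 3.3] -/
theorem half_innerSL_J_sub_flip (J : V →L[ℝ] V) (hJ : ∀ u v, ⟪J u, v⟫ = -⟪u, J v⟫) (u : V) :
    ((2⁻¹ : ℝ) • (innerSL ℝ (E := V)).comp J) u - ((2⁻¹ : ℝ) • (innerSL ℝ (E := V)).comp J).flip u =
      innerSL ℝ (J u) := by
  ext w
  simp only [_root_.sub_apply, _root_.smul_apply, ContinuousLinearMap.comp_apply,
    ContinuousLinearMap.flip_apply, innerSL_apply_apply, smul_eq_mul]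
  rw [hJ w u, real_inner_comm (J u) w]
  ring

/-- **`ι_ξ ω = -iξ` for `ξ` of type `(1,0)`.** For a skew operator `J`, a complex covector `ξ`
with `ξ ∘ J = iξ`, and the dual vectors `u₁ = (Re ξ)♯`, `u₂ = (Im ξ)♯`:
`⟪Ju₁, ·⟫ ⊗ 1 + i (⟪Ju₂, ·⟫ ⊗ 1) = -i ξ`. [cite: Voisin2002, Lemma 6.6 (proof)] -/
theorem innerSL_J_dual_re_add [CompleteSpace V] (J : V →L[ℝ] V) (hJ : ∀ u v, ⟪J u, v⟫ = -⟪u, J v⟫) (ξ : V →L[ℝ] ℂ)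
    (hξ : ∀ v, ξ (J v) = I * ξ v) :
    𝔠₁ (innerSL ℝ (J ((InnerProductSpace.toDual ℝ V).symm (reCLM.comp ξ)))) +
        I • 𝔠₁ (innerSL ℝ (J ((InnerProductSpace.toDual ℝ V).symm (imCLM.comp ξ)))) =
      -(I • ξ) := by
  have hre : ∀ v, (ξ (J v)).re = -(ξ v).im := fun v ↦ by rw [hξ]; simp
  have him : ∀ v, (ξ (J v)).im = (ξ v).re := fun v ↦ by rw [hξ]; simp
  refine ContinuousLinearMap.ext fun w ↦ ?_
  have e1 : ⟪J ((InnerProductSpace.toDual ℝ V).symm (reCLM.comp ξ)), w⟫ = (ξ w).im := by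
    rw [hJ, InnerProductSpace.toDual_symm_apply]
    simp [hre]
  have e2 : ⟪J ((InnerProductSpace.toDual ℝ V).symm (imCLM.comp ξ)), w⟫ = -(ξ w).re := by
    rw [hJ, InnerProductSpace.toDual_symm_apply]
    simp [him]
  simp only [_root_.add_apply, ContinuousLinearMap.comp_apply, ofRealCLM_apply,
    innerSL_apply_apply, _root_.smul_apply, _root_.neg_apply, e1, e2, smul_eq_mul]
  apply Complex.ext <;> simp

end Hermitian

/-! ### Lemma 6.6, symbol form: `P = [∂̄*, L] - i∂` is of order zero -/

section Symbol

open scoped RealInnerProductSpace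

variable {V : Type*} [NormedAddCommGroup V] [InnerProductSpace ℝ V] [FiniteDimensional ℝ V]
  {n : ℕ} [Fact (finrank ℝ V = n)] (o : Orientation ℝ V (Fin n))

/-- The complexified Hodge star (see above). -/
local notation "⋆ℂ[" o ", " h "]" η:max =>
  ContinuousLinearMap.compContinuousAlternatingMap Complex.ofRealCLM
      (hodgeStar o h (ContinuousLinearMap.compContinuousAlternatingMap Complex.reCLM η)) +
    Complex.I • ContinuousLinearMap.compContinuousAlternatingMap Complex.ofRealCLM
      (hodgeStar o h (ContinuousLinearMap.compContinuousAlternatingMap Complex.imCLM η))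

/-- The canonical family `v ↦ θ v ∧ η` (see above). -/
local notation "LefFam[" θ "]" η:max =>
  ContinuousLinearMap.comp (ContinuousAlternatingMap.alternatizeUncurryFinCLM ℝ V ℂ)
    (ContinuousLinearMap.comp (ContinuousLinearMap.flip
      (ContinuousLinearMap.smulRightL ℝ V (V [⋀^Fin _]→L[ℝ] ℂ)) η) θ)

/-- The Lefschetz-type operator `L_θ` (see above). -/
local notation "Lef[" θ "]" η:max => ContinuousAlternatingMap.alternatizeUncurryFin (LefFam[θ] η)

/-- Parity bookkeeping: if `a + 1 + b` is even then `a * b` is even. [folklore] -/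
theorem neg_one_pow_mul_eq_one_of_even {a b c : ℕ} (h : a + 1 + b = c) (hc : Even c) :
    ((-1 : ℂ) ^ (a * b)) = 1 := by
  rcases Nat.even_or_odd a with ha | ha
  · exact (Nat.even_mul.2 (Or.inl ha)).neg_one_pow
  rcases Nat.even_or_odd b with hb | hb
  · exact (Nat.even_mul.2 (Or.inr hb)).neg_one_pow
  exfalso
  have hodd : Odd (a + 1 + b) := (ha.add_odd odd_one).add_odd hb
  rw [h] at hodd
  exact Nat.not_even_iff_odd.2 hodd hc

/-- **Voisin's Lemma 6.6 in symbol form (positive degree).** On an oriented real inner product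
space of even dimension `n` with a skew operator `J` (`⟪Ju, v⟫ = -⟪u, Jv⟫`; the complex structure
of a Hermitian vector space), let `L = L_θ` be the Lefschetz-type operator of `θ v = ½⟪Jv, ·⟫`
(i.e. `L η = ω ∧ η`, `ω(u, v) = ⟪Ju, v⟫`), `⋆_ℂ` the complexified Hodge star and `ξ` a complex
covector of type `(1,0)` (`ξ(Jv) = iξ(v)`). Then for every complex `(j+1)`-form `β`

  `-⋆_ℂ (ξ ∧ ⋆_ℂ (L β)) + L (⋆_ℂ (ξ ∧ ⋆_ℂ β)) - i (ξ ∧ β) = 0`.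

Reading `ξ = ∂f(x)`: `∂̄*(fγ) - f ∂̄*γ = -⋆_ℂ(∂f ∧ ⋆_ℂ γ)` (`∂̄* = -⋆∂⋆`) and `∂(fγ) - f∂γ = ∂f ∧ γ`,
so this is `P(fβ) = f P(β)` for `P = ∂̄*L - L∂̄* - i∂`: the first-order operator `[∂̄*, L] - i∂`
has vanishing symbol, the computational heart of the Kähler identity `[∂̄*, L] = i∂`
(Voisin (2002), Lemma 6.6, flat case via `∂̄* = -∑ 2∂ᵢ ∘ int(∂/∂z̄ᵢ)` and `[int, ω∧]`;
Huybrechts (2005), Prop. 3.1.12 (i)). Proof: `⋆_ℂ(ξ ∧ ⋆_ℂ γ) = ι_ξ γ` in even dimension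
(`cHodgeStar_wedgeOne_cHodgeStar`), `[ι_ξ, L] = (ι_ξ ω) ∧` (`curryLeftC_lefschetz_eq`) and
`ι_ξ ω = -iξ` (`innerSL_J_dual_re_add`). [cite: Voisin2002, §6.1.1 Lemma 6.6, p. 140] -/
theorem symbol_dolbeaultBarAdjoint_lefschetz_sub (hn : Even n) (J : V →L[ℝ] V)
    (hJ : ∀ u v, ⟪J u, v⟫ = -⟪u, J v⟫) (ξ : V →L[ℝ] ℂ) (hξ : ∀ v, ξ (J v) = I * ξ v) {j m₁ m₃ : ℕ}
    (h₁ : (j + 2 + 1) + m₁ = n) (h₂ : (m₁ + 1) + (j + 2) = n) (h₃ : (j + 1) + m₃ = n)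
    (h₄ : (m₃ + 1) + j = n) (β : V [⋀^Fin (j + 1)]→L[ℝ] ℂ) :
    -⋆ℂ[o, h₂] (wedgeOne ξ (⋆ℂ[o, h₁] (Lef[(2⁻¹ : ℝ) • (innerSL ℝ (E := V)).comp J] β))) +
        Lef[(2⁻¹ : ℝ) • (innerSL ℝ (E := V)).comp J] (⋆ℂ[o, h₄] (wedgeOne ξ (⋆ℂ[o, h₃] β))) -
          I • wedgeOne ξ β = 0 := by
  set θ : V →L[ℝ] V →L[ℝ] ℝ := (2⁻¹ : ℝ) • (innerSL ℝ (E := V)).comp J with hθ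
  set u₁ : V := (InnerProductSpace.toDual ℝ V).symm (reCLM.comp ξ) with hu₁
  set u₂ : V := (InnerProductSpace.toDual ℝ V).symm (imCLM.comp ξ) with hu₂
  rw [cHodgeStar_wedgeOne_cHodgeStar o h₁ h₂ ξ, cHodgeStar_wedgeOne_cHodgeStar o h₃ h₄ ξ,
    neg_one_pow_mul_eq_one_of_even h₁ hn, neg_one_pow_mul_eq_one_of_even h₃ hn, one_smul, one_smul,
    curryLeftC_lefschetz_eq θ β u₁ u₂, half_innerSL_J_sub_flip J hJ, half_innerSL_J_sub_flip J hJ,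
    innerSL_J_dual_re_add J hJ ξ hξ, wedgeOne_neg_left, wedgeOne_smul_left]
  abel

/-- **Voisin's Lemma 6.6 in symbol form, degree `0`** (no middle term: `∂̄*` of a function is not
defined): `-⋆_ℂ (ξ ∧ ⋆_ℂ (L β)) - i (ξ ∧ β) = 0` for a complex `0`-form `β`.
[cite: Voisin2002, §6.1.1 Lemma 6.6, p. 140] -/
theorem symbol_dolbeaultBarAdjoint_lefschetz_zero (hn : Even n) (J : V →L[ℝ] V)
    (hJ : ∀ u v, ⟪J u, v⟫ = -⟪u, J v⟫) (ξ : V →L[ℝ] ℂ) (hξ : ∀ v, ξ (J v) = I * ξ v) {m₁ : ℕ}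
    (h₁ : (1 + 1) + m₁ = n) (h₂ : (m₁ + 1) + 1 = n) (β : V [⋀^Fin 0]→L[ℝ] ℂ) :
    -⋆ℂ[o, h₂] (wedgeOne ξ (⋆ℂ[o, h₁] (Lef[(2⁻¹ : ℝ) • (innerSL ℝ (E := V)).comp J] β))) -
        I • wedgeOne ξ β = 0 := by
  set θ : V →L[ℝ] V →L[ℝ] ℝ := (2⁻¹ : ℝ) • (innerSL ℝ (E := V)).comp J with hθ
  set u₁ : V := (InnerProductSpace.toDual ℝ V).symm (reCLM.comp ξ) with hu₁
  set u₂ : V := (InnerProductSpace.toDual ℝ V).symm (imCLM.comp ξ) with hu₂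
  rw [cHodgeStar_wedgeOne_cHodgeStar o h₁ h₂ ξ, neg_one_pow_mul_eq_one_of_even h₁ hn, one_smul,
    curryLeftC_lefschetz_zero θ β u₁ u₂, half_innerSL_J_sub_flip J hJ, half_innerSL_J_sub_flip J hJ,
    innerSL_J_dual_re_add J hJ ξ hξ, wedgeOne_neg_left, wedgeOne_smul_left]
  abel

end Symbol

end Literature.Geometry.Kaehler
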